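import Summits.BirchSwinnertonDyer.Rank1Residual.Additive.KatoDescentAugmentation
import Summits.BirchSwinnertonDyer.Rank1Residual.Additive.KatoDescentIntegralH1RankOne
import Literature.NumberTheory.EllipticCurves.Kato2004.IwasawaH1RankLeOneProofs
import Literature.NumberTheory.EllipticCurves.Kato2004.EulerSystemClassNonvanishingRohrlichProofs
import Literature.NumberTheory.EllipticCurves.CuspFormLFunctionLevelConductorProofs
import HarnessLib

set_option autoImplicit false

/-!
# PR-INV WITHOUT `Kato2004.thm12_4` on the rank-one rows: KATO-RIGID and the witness-independence of the closed
# Perrin-Riou ratio `Kato2004.PRRatio` from TREE THEOREMS at a pin carrying a lifted Kato family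
# (seat `bsd-cm-prr-ty1` g17, cell `bsd-cm`; theorems only: no definition, no named fact, no instance, no `sorry`)

Part 51 of the seat's kernel cut of the Kato–Perrin-Riou skeletons (cruxes stmt-BirchSwinnertonDyer-19945 `EllipticUnitValueSevenOfGZK`,
line `kato_perrin_riou_zp` v5, and stmt-BirchSwinnertonDyer-19223 `CccOneLawOnTypeIstarZero`, line `kato_perrin_riou_istar` v5; both
registered 2026-08-29 with the PURE-CITE stub `stub_printFactsKato : Kato2004.thm12_4 ∧ Kato2004.exists_iwasawaH2Data_fineSelmerDual_embedding_loc
∧ ModularForms.exists_isNewformOf`).  After E47 (`PerrinRiouUnit.aug`, `katoRigid_of_thm12_4`, `prInv_of_lev_of_thm12_4`) the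
display PR-INV of stub 3 reads PR-INV ⟸ {`IsNewformOf.level_eq_conductorNorm`, `Kato2004.thm12_4`}, the named fact `thm12_4` (Kato
Thm. 12.4: `𝐇¹_Γ(T_pW)` finitely generated, torsion free of `Λ`-rank `1`, free under irreducibility) entering at ONE place: E28
`katoRigid_of_thm12_4_of_aug` destructures `⟨-, ⟨hTF, hrank⟩, -⟩ := h12 W p K γ hK hγ I` to make two lifted Kato families
primitively collinear in the rank-one module `I.H` (`exists_primitive_collinear hrank`).

THIS FILE removes that input ON THE RANK-ONE ROWS (the only rows either crux has): at a pin `(K, γ, I)` of a curve `W/ℚ` of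
Mordell–Weil rank `1` with `Ш(W)[p^∞]` finite (on the cruxes' rows: GZK at `r_an = 1`) that carries the `Λ`-adic lift `y₁` of a guarded
Kato family, EVERY consumed clause of Thm. 12.4 (2) is a tree theorem:
* torsion-freeness — `Kato2004.IwasawaH1Data.isTorsionFree` (cell bsd-potss, `Kato2004/IwasawaH1LambdaTorsionFreeProofs.lean`);
* finite generation (12.2.1) — `Kato2004.IwasawaH1Data.module_finite_of_isCyclotomic` (`Kato2004/IwasawaH1ProjZeroKernelProofs.lean`);
* `rank_Λ I.H ≤ 1` — cell bsd-cn100's `Kato2004.IwasawaH1Data.rank_le_one_of_rank_integralH1_le_one` ((14.14.1)-injectivity + module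
  algebra, `Kato2004/IwasawaH1RankLeOneProofs.lean`) fed with (R1) `rank_{ℤ_p} H¹(ℤ[1/p], T_pW) ≤ 1` = this lineage's
  `LocPKummer.rank_integralH1_le_one` (`KatoDescentIntegralH1RankOne.lean`: the Kummer-log functional has torsion kernel in rank one
  with finite `Ш[p^∞]`);
* `I.H ≠ 0` — the lift `y₁` itself is non-zero: `Kato2004.zetaBody_lift_ne_zero_of_rohrlich` (Kato's proof of Thm. 12.5 (1) run on the
  lift, `Kato2004/EulerSystemClassNonvanishingRohrlichProofs.lean`) with Rohrlich's theorem at ANY `p`,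
  `PSRohrlichAtLevel.rohrlich_primePow_of_isNewformOf` (cell bsd-wall, `Theorems/CyclotomicUntwistRohrlichAtLevel.lean`; already in E47's
  import cone, so no new input enters the lines).
So `rank_Λ I.H = 1` (`rank_eq_one_of_rank_integralH1_le_one`) and E28's argument runs verbatim with AUG = the theorem `aug` (E47):
* §1 `katoRigidAt_of_rankOne` — KATO-RIGID AT `(W, p)` (E25's binder `hKR` read at one pair, VERBATIM) for `W` of rank `1` with
  `Ш(W)[p^∞]` finite, from tree theorems only;
* §2 `prInvAt_of_lev_of_katoRigidAt` — E25 `prInv_of_lev_of_unit_of_katoRigid` read POINTWISE at `(W, p)`: its UNIT binder discharged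
  by E27 `unit_holds`, its KATO-RIGID binder taken at the pair only (E25 applies both at the pair of the conclusion; same proof text);
* §3 ★ `prInv_of_lev_of_rankOne (hlev)` / ★ `prInv_of_modularity_of_rankOne (hmod)` — PR-INV (A2's `hPRinv`) with the two row binders
  `W.mordellWeilRank = 1 → Finite (Ш(W)[p^∞]) →` inserted, from `IsNewformOf.level_eq_conductorNorm` resp. `ModularForms.exists_isNewformOf`
  (Carayol's level read from modularity-with-level by the tree's `IsNewformOf.level_eq_conductorNorm_of_exists_isNewformOf'`) ALONE —
  no `Kato2004.thm12_4`.  The count-reading master of the successor file consumes exactly this shape at the row (where GZK gives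
  rank `1` and finite `Ш`).
HONEST LABEL: theorems only, CONDITIONAL on the displayed hypotheses; the registered v5 stubs are NOT touched or closed (the
planner registers skeletons, D-0033/R-SKEL-OWNER); nothing is asserted on 19945 / 19223; Perrin-Riou's conjecture, Kato's Main
Conjecture and Kato's Thm. 12.4 itself (as the tree's named fact, all `W`, clause (3)) are untouched; no summit statement is proved by
this seat; BSD is not proved for any curve.
References: [Kato2004Asterisque] Thm. 12.4 (2) (p. 221), Thm. 12.5 (1) and proof (pp. 221–222), §13.9–Lemma 13.10 (pp. 229–230),
§14.14 (14.14.1) (p. 243) [corpus: paper:doi-10-24033-ast-639 p106–p107, p115, p128]; [RohrlichInventiones1984] Theorem (p. 409);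
[BlochKato1990] Prop. 3.8, Ex. 3.11; [BurnsKuriharaSano2019] Conj. 2.8 (ii) (p. 10); [DiamondShurman2005] Thm. 8.8.3.
-/

noncomputable section

open scoped Classical NumberField BigOperators TensorProduct

open WeierstrassCurve Field IsDedekindDomain NumberField Rat.HeightOneSpectrum CongruenceSubgroup ValuativeRel
  Literature.NumberTheory.EllipticCurves Literature.NumberTheory.EllipticCurves.ModularForms
  Literature.NumberTheory.EllipticCurves.Rank1Residual Literature.NumberTheory.EllipticCurves.Rank1Residual.Typed
  Literature.NumberTheory.EllipticCurves.Kato2004 Literature.NumberTheory.EllipticCurves.IwasawaAlgebra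
  Literature.NumberTheory.EllipticCurves.Kato2004.EulerSystemValues
  Literature.NumberTheory.GaloisRepresentations Literature.NumberTheory.GaloisRepresentations.PeriodRingData
  Literature.NumberTheory.GaloisRepresentations.IsNonarchimedeanLocalField Literature.NumberTheory.PAdicHodge
  Literature.NumberTheory.AdelicBaseChange Literature.NumberTheory.Automorphic
open Summit.BirchSwinnertonDyer.BirchSwinnertonDyer.Theorems.CongruentShaFreeCutKatoKummerLogTorsion
open Summit.BirchSwinnertonDyer.Rank1Residual Summit.BirchSwinnertonDyer.Rank1Residual.Additive

namespace Summit.BirchSwinnertonDyer.Rank1Residual.Additive.PerrinRiouUnit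

/-! ## §1 KATO-RIGID at a rank-one pair from tree theorems (no `thm12_4`) -/

section KatoRigid

set_option backward.isDefEq.respectTransparency false in
set_option maxHeartbeats 1600000 in
/-- **KATO-RIGID AT `(W, p)` for `W` of Mordell–Weil rank `1` with `Ш(W)[p^∞]` finite — WITHOUT `Kato2004.thm12_4`.**  The body is
E25's binder `hKR` (= E28/E47's conclusion) read at the one pair, VERBATIM.  Proof = E28 `katoRigid_of_thm12_4_of_aug` with its line
`obtain ⟨-, ⟨hTF, hrank⟩, -⟩ := h12 W p K γ hK hγ I` replaced by tree theorems: `I.isTorsionFree hγ` (torsion free), the lift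
`y₁ ≠ 0` by `zetaBody_lift_ne_zero_of_rohrlich` + `PSRohrlichAtLevel.rohrlich_primePow_of_isNewformOf` (so `I.H ≠ 0`), and
`rank_Λ I.H = 1` by `rank_eq_one_of_rank_integralH1_le_one` on (R1) `LocPKummer.rank_integralH1_le_one K hrk hsha`; then
`exists_primitive_collinear`, `constantCoeff_mul_kummerLog_eq`, the theorem `aug`, `mul_eq_mul_of_collinear`.
[cite: Kato2004Asterisque, Thm. 12.4 (2) (p. 221), Thm. 12.5 (1) and proof (pp. 221–222), §13.9–Lemma 13.10 (pp. 229–230), §14.14 (14.14.1) (p. 243)]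
[cite: RohrlichInventiones1984, Theorem (p. 409)] [cite: BlochKato1990, Example 3.11] -/
theorem katoRigidAt_of_rankOne (W : WeierstrassCurve ℚ) [W.IsElliptic] [W.IsGloballyMinimal] (p : ℕ) [Fact p.Prime]
    (hrk : W.mordellWeilRank = 1) (hsha : Finite (AddCommGroup.primaryComponent W.sha p)) :
      letI : ContinuousSMul ℤ_[p] (W.tateModule p) := TateModule.continuousSMul_padicInt
      letI : Module.Free ℤ_[p] (W.tateModule p) := W.module_free_tateModule_holds p
      letI : Module.Finite ℤ_[p] (W.tateModule p) := W.module_finite_tateModule_holds p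
      ∀ (hp : p ≠ 2) {N : ℕ} [NeZero N] (f : CuspForm (Gamma0 N) 2), IsNewformOf W f →
      ∀ (ι₁ ι₂ : (n : ℕ) → (CyclotomicField n ℚ →+* ℂ)) (q₁ q₂ : ℚ)
        (Λ₁ Λ₂ : ∀ (k : ℕ) (r : Finset (HeightOneSpectrum (𝓞 ℚ))),
          H1 (tateRep W p) (cycSubgroup p k r) →ₗ[ℤ_[p]] ℚ_[p] ⊗[ℚ] CyclotomicField (cycLevel p k r) ℚ) (e : ℚ_[p]),
        q₁ ≠ 0 → q₂ ≠ 0 → e ≠ 0 → (∀ (k : ℕ) (y : H1 (tateRep W p) (cycSubgroup p k ∅)), Λ₂ k ∅ y = e • Λ₁ k ∅ y) →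
      ∀ (c₁ d₁ a₁ : ℤ) (A₁ : ℕ) (d'₁ : ℤ) (c₂ d₂ a₂ : ℤ) (A₂ : ℕ) (d'₂ : ℤ),
        0 < A₁ → Int.gcd c₁ (6 * p * A₁) = 1 → Int.gcd d₁ (6 * p * N) = 1 → (d₁ : ℤ) * d'₁ ≡ 1 [ZMOD (A₁ : ℤ)] →
        ratCuspFactor f true c₁ d₁ a₁ A₁ d'₁ ≠ 0 →
        0 < A₂ → Int.gcd c₂ (6 * p * A₂) = 1 → Int.gcd d₂ (6 * p * N) = 1 → (d₂ : ℤ) * d'₂ ≡ 1 [ZMOD (A₂ : ℤ)] →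
        ratCuspFactor f true c₂ d₂ a₂ A₂ d'₂ ≠ 0 →
      ∀ (z₁ : ∀ (k : ℕ) (r : (cyclotomicLevelsRat p (badPlaces c₁ d₁ A₁ N)).Ideals),
          H1 (tateRep W p) ((cyclotomicLevelsRat p (badPlaces c₁ d₁ A₁ N)).level k r.1))
        (x₁ : ∀ (k : ℕ) (r : (cyclotomicLevelsRat p (badPlaces c₁ d₁ A₁ N)).Ideals), CyclotomicField (cycLevel p k r.1) ℚ),
        ZetaBody W p f ι₁ ((q₁ : ℚ) : ℝ) Λ₁ c₁ d₁ a₁ A₁ z₁ x₁ →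
      ∀ (z₂ : ∀ (k : ℕ) (r : (cyclotomicLevelsRat p (badPlaces c₂ d₂ A₂ N)).Ideals),
          H1 (tateRep W p) ((cyclotomicLevelsRat p (badPlaces c₂ d₂ A₂ N)).level k r.1))
        (x₂ : ∀ (k : ℕ) (r : (cyclotomicLevelsRat p (badPlaces c₂ d₂ A₂ N)).Ideals), CyclotomicField (cycLevel p k r.1) ℚ),
        ZetaBody W p f ι₂ ((q₂ : ℚ) : ℝ) Λ₂ c₂ d₂ a₂ A₂ z₂ x₂ →
      ∀ (K : ZpExtension ℚ p) (hK : K.IsCyclotomic) (γ : absoluteGaloisGroup ℚ), K.IsTopGenerator γ →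
      ∀ (I : IwasawaH1Data W p K γ) (y₁ y₂ : I.H),
        (∀ n : ℕ, I.proj n y₁ = levelToLayer W p hK hp (badPlaces c₁ d₁ A₁ N) n
          (z₁ (n + 1) (cyclotomicLevelsRat p (badPlaces c₁ d₁ A₁ N)).idealOne)) →
        (∀ n : ℕ, I.proj n y₂ = levelToLayer W p hK hp (badPlaces c₂ d₂ A₂ N) n
          (z₂ (n + 1) (cyclotomicLevelsRat p (badPlaces c₂ d₂ A₂ N)).idealOne)) →
      ∀ (t₁ t₂ : ℚ_[p]), HasLocPKummerLog W p (layerZeroToTop W p K (I.proj 0 y₁)) t₁ →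
        HasLocPKummerLog W p (layerZeroToTop W p K (I.proj 0 y₂)) t₂ →
        e * ((q₁ * ratCuspFactor f true c₁ d₁ a₁ A₁ d'₁ * ∏ ℓ ∈ (p * A₁).primeFactors, eulerFactorAtOne W N ℓ : ℚ) : ℚ_[p]) * t₂ =
          ((q₂ * ratCuspFactor f true c₂ d₂ a₂ A₂ d'₂ * ∏ ℓ ∈ (p * A₂).primeFactors, eulerFactorAtOne W N ℓ : ℚ) : ℚ_[p]) * t₁ := by
  letI instC : ContinuousSMul ℤ_[p] (W.tateModule p) := TateModule.continuousSMul_padicInt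
  letI instF : Module.Free ℤ_[p] (W.tateModule p) := W.module_free_tateModule_holds p
  letI instFi : Module.Finite ℤ_[p] (W.tateModule p) := W.module_finite_tateModule_holds p
  intro hp N _ f hf ι₁ ι₂ q₁ q₂ Λ₁ Λ₂ e hq₁ hq₂ he hΛ c₁ d₁ a₁ A₁ d'₁ c₂ d₂ a₂ A₂ d'₂ hA₁ hc₁ hd₁ hdd₁ hR₁ hA₂ hc₂ hd₂ hdd₂
    hR₂ z₁ x₁ hζ₁ z₂ x₂ hζ₂ K hK γ hγ I y₁ y₂ hy₁ hy₂ t₁ t₂ ht₁ ht₂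
  -- Thm. 12.4 (2) AT THIS PIN from tree theorems: torsion free …
  haveI hTF : Module.IsTorsionFree (IwasawaAlgebra p) I.H := I.isTorsionFree hγ
  -- … non-zero: the lift `y₁` of the first family is non-zero (Kato's Thm. 12.5 (1) argument + Rohrlich at any `p`) …
  have hq₁R : ((q₁ : ℚ) : ℝ) ≠ 0 := by exact_mod_cast hq₁
  have hR₁C : cuspFactor f true (fun _ ↦ (1 : ℂ)) c₁ d₁ a₁ A₁ d'₁ ≠ 0 := by
    rw [cuspFactor_one_eq_ratCuspFactor]; exact_mod_cast hR₁
  have hy₁0 : y₁ ≠ 0 :=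
    zetaBody_lift_ne_zero_of_rohrlich hζ₁ hf hq₁R hA₁ hc₁ hd₁ hdd₁ hR₁C hK hp hy₁
      (Summit.BirchSwinnertonDyer.BirchSwinnertonDyer.Theorems.PSRohrlichAtLevel.rohrlich_primePow_of_isNewformOf (p := p) hf)
  haveI : Nontrivial I.H := nontrivial_of_ne y₁ 0 hy₁0
  -- … of `Λ`-rank one: (R1) `rank_{ℤ_p} H¹(ℤ[1/p], T_pW) ≤ 1` and (R2)
  have hrank : Module.rank (IwasawaAlgebra p) I.H = 1 :=
    I.rank_eq_one_of_rank_integralH1_le_one hK hγ (LocPKummer.rank_integralH1_le_one W p K hrk hsha)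
  -- a primitive collinearity relation and its bottom layer
  obtain ⟨F, G, hFG, hprim⟩ := exists_primitive_collinear hrank y₁ y₂
  have hstar := constantCoeff_mul_kummerLog_eq W p I hFG ht₁ ht₂
  -- AUG (the theorem `aug`, E47)
  have hdag := aug W p hp f hf ι₁ ι₂ q₁ q₂ Λ₁ Λ₂ e hq₁ hq₂ he hΛ c₁ d₁ a₁ A₁ d'₁ c₂ d₂ a₂ A₂ d'₂ hA₁ hc₁ hd₁ hdd₁ hR₁
    hA₂ hc₂ hd₂ hdd₂ hR₂ z₁ x₁ hζ₁ z₂ x₂ hζ₂ K hK γ hγ I y₁ y₂ hy₁ hy₂ F G hFG hprim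
  have hprim' : ((PowerSeries.constantCoeff F : ℤ_[p]) : ℚ_[p]) ≠ 0 ∨
      ((PowerSeries.constantCoeff G : ℤ_[p]) : ℚ_[p]) ≠ 0 :=
    hprim.imp (fun h => mt PadicInt.coe_eq_zero.mp h) (fun h => mt PadicInt.coe_eq_zero.mp h)
  exact mul_eq_mul_of_collinear hprim' hstar hdag

end KatoRigid

/-! ## §2 PR-INV at a pair from the level identification and KATO-RIGID at that pair (E25 pointwise, UNIT discharged) -/

section Pointwise

set_option backward.isDefEq.respectTransparency false in
set_option maxHeartbeats 1600000 in
/-- **PR-INV AT `(W, p)` ⟸ {`IsNewformOf.level_eq_conductorNorm`, KATO-RIGID AT `(W, p)`}** — E25 `prInv_of_lev_of_unit_of_katoRigid` read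
pointwise: two witnesses `ℒ₁, ℒ₂` of the closed ratio `Kato2004.PRRatio W p` differ by a `p`-adic unit.  Same proof text as E25 (§3
there), with the UNIT binder replaced by the theorem `unit_holds` (E27) and KATO-RIGID applied at the pair of the conclusion only.
Nothing about Kato's classes is asserted; Perrin-Riou's conjecture is untouched.
[cite: Kato2004Asterisque, §13.9–Lemma 13.10 (pp. 229–230)] [cite: BlochKato1990, Prop. 3.8 and Ex. 3.11]
[cite: BurnsKuriharaSano2019, Conj. 2.8 (ii) (p. 10)] -/
theorem prInvAt_of_lev_of_katoRigidAt (W : WeierstrassCurve ℚ) [W.IsElliptic] [W.IsGloballyMinimal] (p : ℕ) [Fact p.Prime]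
    (hlev : ∀ (N : ℕ) [NeZero N], IsNewformOf.level_eq_conductorNorm (N := N))
    (hKR :
      letI : ContinuousSMul ℤ_[p] (W.tateModule p) := TateModule.continuousSMul_padicInt
      letI : Module.Free ℤ_[p] (W.tateModule p) := W.module_free_tateModule_holds p
      letI : Module.Finite ℤ_[p] (W.tateModule p) := W.module_finite_tateModule_holds p
      ∀ (hp : p ≠ 2) {N : ℕ} [NeZero N] (f : CuspForm (Gamma0 N) 2), IsNewformOf W f →
      ∀ (ι₁ ι₂ : (n : ℕ) → (CyclotomicField n ℚ →+* ℂ)) (q₁ q₂ : ℚ)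
        (Λ₁ Λ₂ : ∀ (k : ℕ) (r : Finset (HeightOneSpectrum (𝓞 ℚ))),
          H1 (tateRep W p) (cycSubgroup p k r) →ₗ[ℤ_[p]] ℚ_[p] ⊗[ℚ] CyclotomicField (cycLevel p k r) ℚ) (e : ℚ_[p]),
        q₁ ≠ 0 → q₂ ≠ 0 → e ≠ 0 → (∀ (k : ℕ) (y : H1 (tateRep W p) (cycSubgroup p k ∅)), Λ₂ k ∅ y = e • Λ₁ k ∅ y) →
      ∀ (c₁ d₁ a₁ : ℤ) (A₁ : ℕ) (d'₁ : ℤ) (c₂ d₂ a₂ : ℤ) (A₂ : ℕ) (d'₂ : ℤ),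
        0 < A₁ → Int.gcd c₁ (6 * p * A₁) = 1 → Int.gcd d₁ (6 * p * N) = 1 → (d₁ : ℤ) * d'₁ ≡ 1 [ZMOD (A₁ : ℤ)] →
        ratCuspFactor f true c₁ d₁ a₁ A₁ d'₁ ≠ 0 →
        0 < A₂ → Int.gcd c₂ (6 * p * A₂) = 1 → Int.gcd d₂ (6 * p * N) = 1 → (d₂ : ℤ) * d'₂ ≡ 1 [ZMOD (A₂ : ℤ)] →
        ratCuspFactor f true c₂ d₂ a₂ A₂ d'₂ ≠ 0 →
      ∀ (z₁ : ∀ (k : ℕ) (r : (cyclotomicLevelsRat p (badPlaces c₁ d₁ A₁ N)).Ideals),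
          H1 (tateRep W p) ((cyclotomicLevelsRat p (badPlaces c₁ d₁ A₁ N)).level k r.1))
        (x₁ : ∀ (k : ℕ) (r : (cyclotomicLevelsRat p (badPlaces c₁ d₁ A₁ N)).Ideals), CyclotomicField (cycLevel p k r.1) ℚ),
        ZetaBody W p f ι₁ ((q₁ : ℚ) : ℝ) Λ₁ c₁ d₁ a₁ A₁ z₁ x₁ →
      ∀ (z₂ : ∀ (k : ℕ) (r : (cyclotomicLevelsRat p (badPlaces c₂ d₂ A₂ N)).Ideals),
          H1 (tateRep W p) ((cyclotomicLevelsRat p (badPlaces c₂ d₂ A₂ N)).level k r.1))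
        (x₂ : ∀ (k : ℕ) (r : (cyclotomicLevelsRat p (badPlaces c₂ d₂ A₂ N)).Ideals), CyclotomicField (cycLevel p k r.1) ℚ),
        ZetaBody W p f ι₂ ((q₂ : ℚ) : ℝ) Λ₂ c₂ d₂ a₂ A₂ z₂ x₂ →
      ∀ (K : ZpExtension ℚ p) (hK : K.IsCyclotomic) (γ : absoluteGaloisGroup ℚ), K.IsTopGenerator γ →
      ∀ (I : IwasawaH1Data W p K γ) (y₁ y₂ : I.H),
        (∀ n : ℕ, I.proj n y₁ = levelToLayer W p hK hp (badPlaces c₁ d₁ A₁ N) n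
          (z₁ (n + 1) (cyclotomicLevelsRat p (badPlaces c₁ d₁ A₁ N)).idealOne)) →
        (∀ n : ℕ, I.proj n y₂ = levelToLayer W p hK hp (badPlaces c₂ d₂ A₂ N) n
          (z₂ (n + 1) (cyclotomicLevelsRat p (badPlaces c₂ d₂ A₂ N)).idealOne)) →
      ∀ (t₁ t₂ : ℚ_[p]), HasLocPKummerLog W p (layerZeroToTop W p K (I.proj 0 y₁)) t₁ →
        HasLocPKummerLog W p (layerZeroToTop W p K (I.proj 0 y₂)) t₂ →
        e * ((q₁ * ratCuspFactor f true c₁ d₁ a₁ A₁ d'₁ * ∏ ℓ ∈ (p * A₁).primeFactors, eulerFactorAtOne W N ℓ : ℚ) : ℚ_[p]) * t₂ =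
          ((q₂ * ratCuspFactor f true c₂ d₂ a₂ A₂ d'₂ * ∏ ℓ ∈ (p * A₂).primeFactors, eulerFactorAtOne W N ℓ : ℚ) : ℚ_[p]) * t₁)
    (ℒ₁ ℒ₂ : ℚ_[p]) (hℒ₁ : Kato2004.PRRatio W p ℒ₁) (hℒ₂ : Kato2004.PRRatio W p ℒ₂) :
    ∃ w : ℚ_[p], ‖w‖ = 1 ∧ ℒ₂ = w * ℒ₁ := by
  letI instC : ContinuousSMul ℤ_[p] (W.tateModule p) := TateModule.continuousSMul_padicInt
  letI instF : Module.Free ℤ_[p] (W.tateModule p) := W.module_free_tateModule_holds p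
  letI instFi : Module.Finite ℤ_[p] (W.tateModule p) := W.module_finite_tateModule_holds p
  -- the two witnesses, unfolded
  obtain ⟨hp₁, N₁, hN₁, f₁, hf₁, ι₁, q₁, Λ₁, hq₁, hZ₁, c₁, d₁, a₁, A₁, d'₁, hA₁, hc₁, hd₁, hdd₁, hR₁, z₁, x₁, hzeta₁,
    K₁, hK₁, γ₁, hγ₁, I₁, y₁, hy₁, t₁, P₁, lam₁, ht₁, hP₁, hlam₁, hℒ₁eq⟩ := (Kato2004.prRatio_iff W p ℒ₁).mp hℒ₁
  obtain ⟨hp₂, N₂, hN₂, f₂, hf₂, ι₂, q₂, Λ₂, hq₂, hZ₂, c₂, d₂, a₂, A₂, d'₂, hA₂, hc₂, hd₂, hdd₂, hR₂, z₂, x₂, hzeta₂,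
    K₂, hK₂, γ₂, hγ₂, I₂, y₂, hy₂, t₂, P₂, lam₂, ht₂, hP₂, hlam₂, hℒ₂eq⟩ := (Kato2004.prRatio_iff W p ℒ₂).mp hℒ₂
  haveI : NeZero N₁ := hN₁
  haveI : NeZero N₂ := hN₂
  -- equal levels, equal newforms
  obtain rfl : N₁ = N₂ := (hlev N₁ hf₁).trans (hlev N₂ hf₂).symm
  obtain rfl : f₁ = f₂ := hf₁.unique hf₂
  -- equal period ratios
  have hlam : lam₁ = lam₂ := by
    have hΩ : (W.realPeriodRat : ℝ) ≠ 0 := by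
      -- `Ω_W > 0`: the tree's `realPeriod_pos'` on `W ⊗ ℝ` (= `realPeriodRat_pos_holds` / `KatoCurve.realPeriodRat_pos`, inlined)
      haveI : (W.baseChange ℝ).IsElliptic := by rw [baseChange]; infer_instance
      rw [WeierstrassCurve.realPeriodRat_def]
      exact (W.baseChange ℝ).realPeriod_pos'.ne'
    have h : ((lam₁ : ℚ) : ℝ) * W.realPeriodRat = ((lam₂ : ℚ) : ℝ) * W.realPeriodRat := by rw [← hlam₁, ← hlam₂]
    exact_mod_cast mul_right_cancel₀ hΩ h
  -- equal `log_ω²` of the generators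
  have hG := sq_padicLogLocal_map_eq_of_generates W p hP₁ hP₂
  -- UNIT
  obtain ⟨e, he1, hΛ⟩ := unit_holds W p f₁ f₁ ι₁ ι₂ q₁ q₂ Λ₁ Λ₂ hZ₁ hZ₂
  have he0 : e ≠ 0 := fun h => by rw [h, norm_zero] at he1; exact zero_ne_one he1
  -- re-lift witness 2's family into witness 1's pin and move its Kummer logarithm
  obtain ⟨y₂', hy₂', -⟩ :=
    IwasawaH1Data.existsUnique_lift_of_zetaBody p W hK₁ hp₁ I₁ f₁ _ ((q₂ : ℚ) : ℝ) Λ₂ c₂ d₂ a₂ A₂ z₂ x₂ hzeta₂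
  have ht₂' : HasLocPKummerLog W p (layerZeroToTop W p K₁ (I₁.proj 0 y₂')) t₂ := by
    rw [hy₂' 0, layerZeroToTop_levelToLayer_zero_eq W p hK₁ hK₂ hp₁ (badPlaces c₂ d₂ A₂ N₁), ← hy₂ 0]
    exact ht₂
  -- KATO-RIGID
  have hkr := hKR hp₁ f₁ hf₁ ι₁ ι₂ q₁ q₂ Λ₁ Λ₂ e hq₁ hq₂ he0 hΛ c₁ d₁ a₁ A₁ d'₁ c₂ d₂ a₂ A₂ d'₂ hA₁ hc₁ hd₁ hdd₁ hR₁
    hA₂ hc₂ hd₂ hdd₂ hR₂ z₁ x₁ hzeta₁ z₂ x₂ hzeta₂ K₁ hK₁ γ₁ hγ₁ I₁ y₁ y₂' hy₁ hy₂' t₁ t₂ ht₁ ht₂'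
  -- the constants are non-zero
  set M₁ : ℚ := q₁ * ratCuspFactor f₁ true c₁ d₁ a₁ A₁ d'₁ * ∏ ℓ ∈ (p * A₁).primeFactors, eulerFactorAtOne W N₁ ℓ with hM₁
  set M₂ : ℚ := q₂ * ratCuspFactor f₁ true c₂ d₂ a₂ A₂ d'₂ * ∏ ℓ ∈ (p * A₂).primeFactors, eulerFactorAtOne W N₁ ℓ with hM₂
  have hE₁ : ∀ ℓ ∈ (p * A₁).primeFactors, eulerFactorAtOne W N₁ ℓ ≠ 0 := fun ℓ hℓ =>
    eulerFactorAtOne_ne_zero W hf₁ (Nat.prime_of_mem_primeFactors hℓ)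
  have hE₂ : ∀ ℓ ∈ (p * A₂).primeFactors, eulerFactorAtOne W N₁ ℓ ≠ 0 := fun ℓ hℓ =>
    eulerFactorAtOne_ne_zero W hf₁ (Nat.prime_of_mem_primeFactors hℓ)
  have hM₁0 : ((M₁ : ℚ) : ℚ_[p]) ≠ 0 := by
    have : M₁ ≠ 0 := mul_ne_zero (mul_ne_zero hq₁ hR₁) (Finset.prod_ne_zero_iff.mpr hE₁)
    exact_mod_cast this
  have hM₂0 : ((M₂ : ℚ) : ℚ_[p]) ≠ 0 := by
    have : M₂ ≠ 0 := mul_ne_zero (mul_ne_zero hq₂ hR₂) (Finset.prod_ne_zero_iff.mpr hE₂)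
    exact_mod_cast this
  set G₁ : ℚ_[p] := padicLogLocal W p (Affine.Point.map (W' := W.toAffine) (S := ℚ) (Algebra.ofId ℚ ℚ_[p]) P₁) with hG₁
  set G₂ : ℚ_[p] := padicLogLocal W p (Affine.Point.map (W' := W.toAffine) (S := ℚ) (Algebra.ofId ℚ ℚ_[p]) P₂) with hG₂
  by_cases hG0 : G₁ = 0
  · -- rank `0`: both ratios vanish (`x / 0 = 0`)
    refine ⟨1, norm_one, ?_⟩
    have hG₂0 : G₂ ^ 2 = 0 := by rw [← hG, hG0]; ring
    rw [hℒ₂eq, hℒ₁eq, hG0, hG₂0]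
    simp
  · refine ⟨e⁻¹, by rw [norm_inv, he1, inv_one], ?_⟩
    have hG2 : G₁ ^ 2 ≠ 0 := pow_ne_zero 2 hG0
    rw [hℒ₂eq, hℒ₁eq, ← hlam, ← hG]
    field_simp
    linear_combination (((lam₁ : ℚ) : ℚ_[p])) * hkr

end Pointwise

/-! ## §3 PR-INV on the rank-one rows: from the level identification / modularity-with-level ALONE -/

section RankOne

/-- ★ **PR-INV ON THE RANK-ONE ROWS ⟸ `IsNewformOf.level_eq_conductorNorm` ALONE (no `Kato2004.thm12_4`)**: A2's display `hPRinv`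
with the two row binders `W.mordellWeilRank = 1 → Finite (Ш(W)[p^∞]) →` inserted — two Kato–Perrin-Riou classes of a rank-one
curve with finite `Ш[p^∞]` differ by a `p`-adic unit.  `prInvAt_of_lev_of_katoRigidAt` ∘ `katoRigidAt_of_rankOne`.  CONDITIONAL on
the level identification (Carayol); nothing asserted on 19945 / 19223; BSD is not proved for any curve.
[cite: Kato2004Asterisque, Thm. 12.4 (2) (p. 221), Thm. 12.5 (1) (pp. 221–222), §13.9–Lemma 13.10 (pp. 229–230)]
[cite: RohrlichInventiones1984, Theorem (p. 409)] [cite: BurnsKuriharaSano2019, Conj. 2.8 (ii) (p. 10)] -/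
theorem prInv_of_lev_of_rankOne (hlev : ∀ (N : ℕ) [NeZero N], IsNewformOf.level_eq_conductorNorm (N := N)) :
    ∀ (W : WeierstrassCurve ℚ) [W.IsElliptic] [W.IsGloballyMinimal] (p : ℕ) [Fact p.Prime] (ℒ₁ ℒ₂ : ℚ_[p]),
      W.mordellWeilRank = 1 → Finite (AddCommGroup.primaryComponent W.sha p) →
      Kato2004.PRRatio W p ℒ₁ → Kato2004.PRRatio W p ℒ₂ → ∃ w : ℚ_[p], ‖w‖ = 1 ∧ ℒ₂ = w * ℒ₁ :=
  fun W _ _ p _ ℒ₁ ℒ₂ hrk hsha hℒ₁ hℒ₂ ↦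
    prInvAt_of_lev_of_katoRigidAt W p hlev (katoRigidAt_of_rankOne W p hrk hsha) ℒ₁ ℒ₂ hℒ₁ hℒ₂

/-- ★ **PR-INV ON THE RANK-ONE ROWS ⟸ modularity-with-level `ModularForms.exists_isNewformOf` ALONE** (Carayol's level identification
read from it by the tree's `IsNewformOf.level_eq_conductorNorm_of_exists_isNewformOf'`) — the key of the registered v5 cite stubs.
CONDITIONAL; nothing asserted on 19945 / 19223; BSD is not proved for any curve.
[cite: Kato2004Asterisque, Thm. 12.5 (1) (pp. 221–222), §13.9–Lemma 13.10 (pp. 229–230)] [cite: DiamondShurman2005, Thm. 8.8.1 and Thm. 8.8.3]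
[cite: BreuilConradDiamondTaylor2001, Thm. A] -/
theorem prInv_of_modularity_of_rankOne (hmod : exists_isNewformOf) :
    ∀ (W : WeierstrassCurve ℚ) [W.IsElliptic] [W.IsGloballyMinimal] (p : ℕ) [Fact p.Prime] (ℒ₁ ℒ₂ : ℚ_[p]),
      W.mordellWeilRank = 1 → Finite (AddCommGroup.primaryComponent W.sha p) →
      Kato2004.PRRatio W p ℒ₁ → Kato2004.PRRatio W p ℒ₂ → ∃ w : ℚ_[p], ‖w‖ = 1 ∧ ℒ₂ = w * ℒ₁ :=
  prInv_of_lev_of_rankOne fun N _ ↦ IsNewformOf.level_eq_conductorNorm_of_exists_isNewformOf' (N := N) hmod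

end RankOne

end Summit.BirchSwinnertonDyer.Rank1Residual.Additive.PerrinRiouUnit

end
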